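import Summits.CriticalPhenomena.PercolationContinuityZ3.Theorems.PercNearOneGluingNoHeavyQuantGatedSliceMixLawQ4TopMid
import Summits.CriticalPhenomena.PercolationContinuityZ3.Theorems.PercNearOneGluingNoHeavyQuantGatedSliceMixLawCells
import HarnessLib

/-!
# QUANT lane R8, T-DEC, leg (III), blob case — node `LawDec.GatedSliceMixLaw'`: CELL Q4 REDUCES TO CELL QK (`MixLawCellQK → MixLawCellQ4`),
# so the node `GatedSliceMixLaw'` is `MixLawCellQH ∧ MixLawCellQK`

builds on p205010 (kernel theorem, internal audit signed; external expert review pending)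

Support file (`--supports stmt-CriticalPhenomena-4575`), QUANT lane, LEAD seat prim-quant-lead (gen 36), rung R8 of
`run/shared/lean/prim/quant/LADDER.md`.  Theorems only, standard axioms, no sorries, no definitions.

THE POINT.  After census-2 g61's `gatedSliceMixLaw'_of_Qcells : MixLawCellQ4 → MixLawCellQH → MixLawCellQK → GatedSliceMixLaw'`
(`…QuantGatedSliceMixLawRegimeBTopBelowCell`, p369789 ✓) the node `GatedSliceMixLaw'` (hence CW = `WindowMixDEC`, the blob case of leg (III)) is the
three Q-alone cells of `…QuantGatedSliceMixLawCells` (typer g30).  Cell Q4 (`k₁` a `t`-low, its twin `k₁ + a ≤ j` a mid, `k₂ ≤ j`) needs no file of its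
own: by cases on the top, (a) `k₂ + a ≤ j` (no giant) is Theorem A at the moved law's own mean (arm-1 g41's `mixLawQ_decAtT_of_top_le`, `…QAlone`);
(b) `k₂ + a ≥ j+1` with the top a MID (`t ≤ 2k₂`) is arm-1 g41's assembled theorem `mixLawQ_decAtT_cellQ4_topMid` (`…Q4TopMid`: twin closed / open,
top open heavy / light, twin above `t`); (c) `k₂ + a ≥ j+1` with the top a `t`-LOW (`2k₂ < t`) is literally an instance of cell QK.

* **`LawDec.mixLawCellQ4_of_QK : MixLawCellQK → MixLawCellQ4`**;
* consequently the node is `MixLawCellQH ∧ MixLawCellQK` (`gatedSliceMixLaw'_of_Qcells (mixLawCellQ4_of_QK hQK) hQH hQK`; arm-1's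
  `mixLawCellQH_holds` / `mixLawCellQK_holds` were assembled in its session but are not yet landed: WAKE-arm-1-g36-QCELLS.md).
HONEST STATUS: `MixLawCellQH`, `MixLawCellQK` (hence `GatedSliceMixLaw'`, CW), `GateMove`, `SingleGateConvClosed`, `TreeDEC`, `FarTreeRow` OPEN; RATE class
log\* / honest sentence unchanged.

[this work]; cells: prim-quant-stmt g30; class theorems: prim-quant-arm-1 g41; assembly: prim-quant-census-2 g61 (this lane).  The gluing rows served
[cite: KozmaNitzan2024, Conjecture 3 (p. 15)]; product measure [cite: Grimmett1999, §1.3 p. 10].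
-/

noncomputable section

namespace Summit.CriticalPhenomena.PercolationContinuityZ3.Theorems

namespace Quant

open Finset

namespace LawDec

/-- **Cell Q4 follows from cell QK.**  Cases on the top: no giant ⟹ Theorem A (`mixLawQ_decAtT_of_top_le`); giant and the top a mid ⟹
`mixLawQ_decAtT_cellQ4_topMid`; giant and the top a `t`-low ⟹ cell QK verbatim. [this work] -/
theorem mixLawCellQ4_of_QK (hQK : MixLawCellQK) : MixLawCellQ4 := by
  intro y z g S lam a j M k₁ k₂ hy0 hy1 hz0 hz1 hg1 hyg ha hjM hS0 hta hSj hSM hk hk₂M hlam0 hlam1 hmean hk₁j hk₁low hPj hPmid hKj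
  by_cases hG : j + 1 ≤ k₂ + a
  · by_cases hKmid : S + (a : ℝ) * g * (1 - z) ≤ 2 * (k₂ : ℝ)
    · exact mixLawQ_decAtT_cellQ4_topMid y z g S lam a j M k₁ k₂ hy0 hy1 hz0 hz1 hg1 hyg ha hta hk hk₂M hlam0 hlam1 hmean hk₁j
        hk₁low hPj hPmid hKj hKmid hG
    · exact hQK y z g S lam a j M k₁ k₂ hy0 hy1 hz0 hz1 hg1 hyg ha hjM hS0 hta hSj hSM hk hk₂M hlam0 hlam1 hmean hKj (not_le.1 hKmid)
  · have hg0 : 0 ≤ g := by nlinarith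
    have h := mixLawQ_decAtT_of_top_le y z g lam a j M k₁ k₂ hy0.le hy1 hz0 hz1.le hg0 hg1 hyg hk hk₂M hlam0 hlam1
      (by rw [hmean]; exact hta) (by omega)
    have ht : (1 - z) * ((k₁ : ℝ) + ((k₂ : ℝ) - k₁) * lam) + (a : ℝ) * g - z * (a : ℝ) * g = S + (a : ℝ) * g * (1 - z) := by
      rw [hmean]; ring
    rw [ht] at h
    exact h

end LawDec

end Quant

end Summit.CriticalPhenomena.PercolationContinuityZ3.Theorems
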